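import Summits.AtomisticToContinuum.Crystallization.Theorems.OverbindingBudgetAffineRunCutSheetStraddle

/-!
# `OverbindingBudget` / crux `RobustDefectLimitWindows` (stmt-AtomisticToContinuum-31280) — «RunCut» part 22D-α «SHEETNETS»:
# THE NET SITES UNDER THE STRADDLE, THE WAYPOINTS OF THE ACCESS, AND THE IN-PLANE TWO-PLANE POINT

Support file (lens-4 g89; order of record (2c), `ρ₁ = 30`; memo `g89/memo/TWOSHEET-g89.md` §7 = the ENDGAME LEDGER).  The pointwise
crossing-exclusion engine `no_crossing` (part 22D-β) feeds TREE `…CrossCore.crossing_pair_absurd` with: a straddling pair `(b, b′)` of a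
foreign steepest chain (part 22C `steep_straddle`), and under each of `b`, `b′` a NET SITE of the local sheet — flat to `ν/10`, laterally within
`(3/4) ν`, distinct from it.  This file supplies the net sites and the remaining Euclidean glue of the assembly:

* §1 lateral algebra for `lat_n X = X − ⟪n, X⟫ n` (homogeneity, sign- and shift-invariance, `‖lat_n X‖ ≤ ‖X‖`, `‖X‖` from height/lateral,
  lateral drift `≤ 0.62 ν` of a steep step, segments stay in balls);
* §2 `axes_apart` — a vector within `δ₁` of `±n` and within `δ₂` of `±m` (`n`, `m` unit) forces `|⟪n, m⟫| ≥ 1 − (δ₁ + δ₂)²/2` (so a net site, whose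
  chart axis follows the local normal, is never a straddle site, whose axis follows the foreign one: `0.99 > 0.379`);
* §3 `two_plane_inplane` — the two-plane point of TREE `…TwoPlane.two_plane_point` in EXPLICIT form `z = x + α n₁ + β n₂`: `‖z − x‖ ≤ K d`
  (`(1 − c) K² ≥ 2`) AND the in-plane bounds `‖z − pᵢ‖ ≤ ‖x − pᵢ‖ + M d` (`(1 − c) M² ≥ 1 + c`; the tree lemma exports only the first: memo §7, 1–2);
* §4 `waypoints` — eight waypoints on the segment `[P, Z]` of the local plane with lateral spacing `≤ (23/5) ν` and a last gap `≤ (37/25) ν`, whenever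
  `‖lat_n (Z − P)‖ ≤ (957/25) ν = (8 · 23/5 + 37/25) ν` (the input format of part 22B `access`);
* §5 ★ `net_hops` / ★★ `net_site` — from an h-site `a₀` of the ball with unit axis `n`, ONE fresh chain pursues four targets `V 0 … V 3` of the local
  plane (first lateral radius `≤ 2.12 ν_0`, consecutive spacing `≤ 1.48 ν_0`; all hops of MODE `(3, 2.12)` of part 22A `sheet_hop`, chain length
  `≤ 3 (q + 1) ≤ 12`); the stopping site under `V q` is in the ball, an h-site, of positive scale `ν`, flat to `ν/10` over the plane `(y a₀, n)`, laterally
  within `(3/4) ν` of `V q`, and its chart axis is within `1/250` of `±n` (part 22B `chain_guard` at `t ≤ 12`).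
[this file: 0 definitions, 17 theorems; imports `…RunCutSheetStraddle` (part 22C) only; standard axioms]
-/

namespace Summit.AtomisticToContinuum.Crystallization.Theorems.OverbindingBudgetAffineRunCutSheetNets

open scoped InnerProductSpace
open Literature.Geometry.DiscreteGeometry
open Summit.AtomisticToContinuum.Crystallization.Theorems.OverbindingBudgetAffineCompressedCutEstablish (nearestDist_pos_of_frame)
open Summit.AtomisticToContinuum.Crystallization.Theorems.OverbindingBudgetAffineRunCutSheetCross (norm_sq_eq_height_sq_add_lateral_sq)
open Summit.AtomisticToContinuum.Crystallization.Theorems.OverbindingBudgetAffineRunCutSheetHop (site_charts sheet_hop)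
open Summit.AtomisticToContinuum.Crystallization.Theorems.OverbindingBudgetAffineRunCutSheetAccess (lat_add_le chain_guard)

variable {N : ℕ}

local notation "E3" => EuclideanSpace ℝ (Fin 3)

/-! ## §1 Lateral algebra -/

/-- `lat_n (r X) = r · lat_n X`. [this file · kind: glue] -/
theorem lat_smul (n : E3) (r : ℝ) (X : E3) : (r • X) - ⟪n, r • X⟫_ℝ • n = r • (X - ⟪n, X⟫_ℝ • n) := by
  rw [real_inner_smul_right, smul_sub, smul_smul]

/-- Shifting along the (unit) axis does not change the lateral part: `lat_n (X − h n) = lat_n X`. [this file · kind: glue] -/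
theorem lat_axis_shift {n : E3} (hn : ‖n‖ = 1) (X : E3) (h : ℝ) :
    (X - h • n) - ⟪n, X - h • n⟫_ℝ • n = X - ⟪n, X⟫_ℝ • n := by
  have hnn : ⟪n, n⟫_ℝ = 1 := by rw [real_inner_self_eq_norm_sq, hn]; norm_num
  rw [inner_sub_right, real_inner_smul_right, hnn, mul_one, sub_smul]; abel

/-- The lateral part is blind to the sign of the axis: `lat_{σ n} = lat_n` for `σ = ±1`. [this file · kind: glue] -/
theorem lat_sign {n : E3} {σ : ℝ} (hσ : σ = 1 ∨ σ = -1) (X : E3) :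
    X - ⟪σ • n, X⟫_ℝ • (σ • n) = X - ⟪n, X⟫_ℝ • n := by
  rw [real_inner_smul_left, smul_smul]
  rcases hσ with rfl | rfl <;> simp

/-- `|⟪σ n, X⟫| = |⟪n, X⟫|` for `σ = ±1`. [this file · kind: glue] -/
theorem abs_inner_sign {n : E3} {σ : ℝ} (hσ : σ = 1 ∨ σ = -1) (X : E3) : |⟪σ • n, X⟫_ℝ| = |⟪n, X⟫_ℝ| := by
  rw [real_inner_smul_left, abs_mul]
  rcases hσ with rfl | rfl <;> simp

/-- `‖lat_n X‖ ≤ ‖X‖` (`n` unit). [this file · kind: glue] -/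
theorem lat_norm_le {n : E3} (hn : ‖n‖ = 1) (X : E3) : ‖X - ⟪n, X⟫_ℝ • n‖ ≤ ‖X‖ := by
  have h := norm_sq_eq_height_sq_add_lateral_sq hn X
  exact le_of_pow_le_pow_left₀ two_ne_zero (norm_nonneg _) (by nlinarith [sq_nonneg ⟪n, X⟫_ℝ])

/-- `‖X‖ ≤ r` from `|⟪n, X⟫| ≤ h`, `‖lat_n X‖ ≤ l`, `h² + l² ≤ r²`. [this file · kind: glue] -/
theorem norm_le_of_height_of_lateral {n X : E3} (hn : ‖n‖ = 1) {h l r : ℝ} (hh : |⟪n, X⟫_ℝ| ≤ h)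
    (hl : ‖X - ⟪n, X⟫_ℝ • n‖ ≤ l) (hr0 : 0 ≤ r) (hr : h ^ 2 + l ^ 2 ≤ r ^ 2) : ‖X‖ ≤ r := by
  have hd := norm_sq_eq_height_sq_add_lateral_sq hn X
  have h1 : ⟪n, X⟫_ℝ ^ 2 ≤ h ^ 2 := by rw [← sq_abs]; exact pow_le_pow_left₀ (abs_nonneg _) hh 2
  have h2 : ‖X - ⟪n, X⟫_ℝ • n‖ ^ 2 ≤ l ^ 2 := pow_le_pow_left₀ (norm_nonneg _) hl 2
  exact le_of_pow_le_pow_left₀ two_ne_zero hr0 (by linarith)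

/-- The lateral drift of a STEEP step: rise `≥ 0.79 ν` and length `≤ 1.0011 ν` give `‖lat_n s‖ ≤ 0.62 ν` (`1.0011² − 0.79² = 0.3781 ≤ 0.62²`).
[this file · kind: glue] -/
theorem lat_le_of_rise {n s : E3} (hn : ‖n‖ = 1) {ν : ℝ} (hν : 0 ≤ ν) (hrise : 79 / 100 * ν ≤ ⟪n, s⟫_ℝ)
    (hlen : ‖s‖ ≤ 10011 / 10000 * ν) : ‖s - ⟪n, s⟫_ℝ • n‖ ≤ 31 / 50 * ν := by
  have hd := norm_sq_eq_height_sq_add_lateral_sq hn s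
  have h1 : (79 / 100 * ν) ^ 2 ≤ ⟪n, s⟫_ℝ ^ 2 := pow_le_pow_left₀ (by positivity) hrise 2
  have h2 : ‖s‖ ^ 2 ≤ (10011 / 10000 * ν) ^ 2 := pow_le_pow_left₀ (norm_nonneg _) hlen 2
  exact le_of_pow_le_pow_left₀ two_ne_zero (by positivity) (by nlinarith)

/-- Segments stay in balls: `dist P X ≤ R`, `dist Z X ≤ R`, `0 ≤ θ ≤ 1` ⇒ `dist (P + θ (Z − P)) X ≤ R`. [this file · kind: glue] -/
theorem segment_dist_le {P Z X : E3} {θ R : ℝ} (h0 : 0 ≤ θ) (h1 : θ ≤ 1) (hP : dist P X ≤ R) (hZ : dist Z X ≤ R) :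
    dist (P + θ • (Z - P)) X ≤ R := by
  rw [dist_eq_norm] at hP hZ ⊢
  have e : P + θ • (Z - P) - X = (1 - θ) • (P - X) + θ • (Z - X) := by
    simp only [sub_smul, one_smul, smul_sub]; abel
  rw [e]
  have hA : ‖(1 - θ) • (P - X)‖ = (1 - θ) * ‖P - X‖ := by rw [norm_smul, Real.norm_of_nonneg (sub_nonneg.2 h1)]
  have hB : ‖θ • (Z - X)‖ = θ * ‖Z - X‖ := by rw [norm_smul, Real.norm_of_nonneg h0]
  have hA' := mul_le_mul_of_nonneg_left hP (sub_nonneg.2 h1)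
  have hB' := mul_le_mul_of_nonneg_left hZ h0
  calc ‖(1 - θ) • (P - X) + θ • (Z - X)‖ ≤ ‖(1 - θ) • (P - X)‖ + ‖θ • (Z - X)‖ := norm_add_le _ _
    _ ≤ R := by rw [hA, hB]; linarith

/-! ## §2 Chart axes following two far-apart normals belong to different sites -/

/-- A vector `u` within `δ₁` of `σ₁ n` and within `δ₂` of `σ₂ m` (`n`, `m` unit, `σᵢ = ±1`) forces `|⟪n, m⟫| ≥ 1 − (δ₁ + δ₂)²/2`.
[this file · kind: glue] -/
theorem axes_apart {u n m : E3} {σ₁ σ₂ δ₁ δ₂ : ℝ} (hn : ‖n‖ = 1) (hm : ‖m‖ = 1) (hσ₁ : σ₁ = 1 ∨ σ₁ = -1) (hσ₂ : σ₂ = 1 ∨ σ₂ = -1)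
    (h1 : ‖u - σ₁ • n‖ ≤ δ₁) (h2 : ‖u - σ₂ • m‖ ≤ δ₂) : 1 - (δ₁ + δ₂) ^ 2 / 2 ≤ |⟪n, m⟫_ℝ| := by
  have hd : ‖σ₁ • n - σ₂ • m‖ ≤ δ₁ + δ₂ := by
    have e : σ₁ • n - σ₂ • m = (u - σ₂ • m) - (u - σ₁ • n) := by abel
    rw [e]; exact (norm_sub_le _ _).trans (by linarith)
  have hnn : ⟪n, n⟫_ℝ = 1 := by rw [real_inner_self_eq_norm_sq, hn]; norm_num
  have hmm : ⟪m, m⟫_ℝ = 1 := by rw [real_inner_self_eq_norm_sq, hm]; norm_num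
  have hsq : ‖σ₁ • n - σ₂ • m‖ ^ 2 = 2 - 2 * (σ₁ * σ₂) * ⟪n, m⟫_ℝ := by
    rw [← real_inner_self_eq_norm_sq]
    simp only [inner_sub_left, inner_sub_right, real_inner_smul_left, real_inner_smul_right, hnn, hmm, real_inner_comm n m]
    rcases hσ₁ with rfl | rfl <;> rcases hσ₂ with rfl | rfl <;> ring
  have h3 : ‖σ₁ • n - σ₂ • m‖ ^ 2 ≤ (δ₁ + δ₂) ^ 2 := pow_le_pow_left₀ (norm_nonneg _) hd 2
  have h4 : (σ₁ * σ₂) * ⟪n, m⟫_ℝ ≤ |⟪n, m⟫_ℝ| := by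
    have e : |(σ₁ * σ₂) * ⟪n, m⟫_ℝ| = |⟪n, m⟫_ℝ| := by
      rw [abs_mul]; rcases hσ₁ with rfl | rfl <;> rcases hσ₂ with rfl | rfl <;> simp
    rw [← e]; exact le_abs_self _
  rw [hsq] at h3
  linarith

/-! ## §3 The two-plane point with in-plane bounds -/

/-- Real glue of §3: `|g| ≤ c < 1`, `|δ|, |δ′| ≤ d`, `β (1 − g²) = g δ − δ′`, `(1 − c) M² ≥ 1 + c` ⇒ `β² (1 − g²) ≤ (M d)²`.
[this file · kind: glue] -/
theorem inplane_coeff_bound {g c δ δ' d M β : ℝ} (hg : |g| ≤ c) (hc1 : c < 1) (hδ : |δ| ≤ d) (hδ' : |δ'| ≤ d)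
    (hβ : β * (1 - g ^ 2) = g * δ - δ') (hM : 1 + c ≤ (1 - c) * M ^ 2) : β ^ 2 * (1 - g ^ 2) ≤ (M * d) ^ 2 := by
  have hga : |g| ^ 2 = g ^ 2 := sq_abs g
  have hd0 : 0 ≤ d := (abs_nonneg _).trans hδ
  have hg0 : 0 ≤ |g| := abs_nonneg g
  have hpos : 0 < 1 - |g| := by linarith
  have hpos' : 0 < 1 + |g| := by linarith
  have h5 : |g * δ - δ'| ≤ (1 + |g|) * d := by
    have e := abs_sub (g * δ) δ'
    rw [abs_mul] at e
    nlinarith [mul_le_mul_of_nonneg_left hδ hg0, abs_nonneg δ]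
  have h6 : (β * (1 - g ^ 2)) ^ 2 ≤ ((1 + |g|) * d) ^ 2 := by
    rw [hβ, ← sq_abs (g * δ - δ')]; exact pow_le_pow_left₀ (abs_nonneg _) h5 2
  have h7 : β ^ 2 * (1 - g ^ 2) * (1 - |g|) * (1 + |g|) ≤ (1 + |g|) * d ^ 2 * (1 + |g|) := by
    have e1 : β ^ 2 * (1 - g ^ 2) * (1 - |g|) * (1 + |g|) = (β * (1 - g ^ 2)) ^ 2 := by rw [← hga]; ring
    rw [e1]; nlinarith [h6]
  have h8 : β ^ 2 * (1 - g ^ 2) * (1 - |g|) ≤ (1 + |g|) * d ^ 2 := le_of_mul_le_mul_right h7 hpos'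
  have h9 : (1 + |g|) * d ^ 2 ≤ (M * d) ^ 2 * (1 - |g|) := by
    have e2 : (1 + |g|) * d ^ 2 ≤ ((1 - c) * M ^ 2) * d ^ 2 := mul_le_mul_of_nonneg_right (by linarith) (sq_nonneg d)
    have e3 : ((1 - c) * M ^ 2) * d ^ 2 ≤ ((1 - |g|) * M ^ 2) * d ^ 2 :=
      mul_le_mul_of_nonneg_right (mul_le_mul_of_nonneg_right (by linarith) (sq_nonneg M)) (sq_nonneg d)
    nlinarith [e2, e3]
  exact le_of_mul_le_mul_right (h8.trans h9) hpos

/-- Vector glue of §3: `‖β (n₂ − g n₁)‖² = β² (1 − g²)` for unit `n₁`, `n₂` with `⟪n₁, n₂⟫ = g`. [this file · kind: glue] -/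
theorem norm_sq_smul_sub_axis {n₁ n₂ : E3} {g : ℝ} (h₁ : ‖n₁‖ = 1) (h₂ : ‖n₂‖ = 1) (hg : ⟪n₁, n₂⟫_ℝ = g) (β : ℝ) :
    ‖β • (n₂ - g • n₁)‖ ^ 2 = β ^ 2 * (1 - g ^ 2) := by
  have hn11 : ⟪n₁, n₁⟫_ℝ = 1 := by rw [real_inner_self_eq_norm_sq, h₁]; norm_num
  have hn22 : ⟪n₂, n₂⟫_ℝ = 1 := by rw [real_inner_self_eq_norm_sq, h₂]; norm_num
  have hn21 : ⟪n₂, n₁⟫_ℝ = g := by rw [real_inner_comm, hg]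
  rw [← real_inner_self_eq_norm_sq]
  simp only [inner_sub_left, inner_sub_right, real_inner_smul_left, real_inner_smul_right, hn11, hn22, hn21, hg]
  ring

/-- Real glue of §3: the Gram system of the two planes solved explicitly (`α = (g δ₂ − δ₁)/(1 − g²)`, `β = (g δ₁ − δ₂)/(1 − g²)`).
[this file · kind: glue] -/
theorem gram_identities (g δ₁ δ₂ : ℝ) (hD : 1 - g ^ 2 ≠ 0) :
    (g * δ₂ - δ₁) / (1 - g ^ 2) + g * ((g * δ₁ - δ₂) / (1 - g ^ 2)) = -δ₁ ∧
    g * ((g * δ₂ - δ₁) / (1 - g ^ 2)) + (g * δ₁ - δ₂) / (1 - g ^ 2) = -δ₂ ∧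
    (g * δ₁ - δ₂) / (1 - g ^ 2) * (1 - g ^ 2) = g * δ₁ - δ₂ ∧
    (g * δ₂ - δ₁) / (1 - g ^ 2) * (1 - g ^ 2) = g * δ₂ - δ₁ ∧
    (1 - g ^ 2) * (((g * δ₂ - δ₁) / (1 - g ^ 2)) ^ 2 + ((g * δ₁ - δ₂) / (1 - g ^ 2)) ^ 2 +
      2 * ((g * δ₂ - δ₁) / (1 - g ^ 2)) * ((g * δ₁ - δ₂) / (1 - g ^ 2)) * g) = δ₁ ^ 2 + δ₂ ^ 2 - 2 * g * δ₁ * δ₂ := by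
  refine ⟨?_, ?_, div_mul_cancel₀ _ hD, div_mul_cancel₀ _ hD, ?_⟩
  · field_simp; ring
  · field_simp; ring
  · field_simp; ring

/-- Real glue of §3 (the norm bound of TREE `two_plane_point`): `(1 − g²) S = δ₁² + δ₂² − 2 g δ₁ δ₂`, `S ≥ 0`, `|g| ≤ c < 1`, `|δᵢ| ≤ d`,
`(1 − c) K² ≥ 2` ⇒ `S ≤ (K d)²`. [this file · kind: glue] -/
theorem two_plane_norm_real {g c d K S δ₁ δ₂ : ℝ} (hg : |g| ≤ c) (hc1 : c < 1) (hd₁ : |δ₁| ≤ d) (hd₂ : |δ₂| ≤ d) (hS0 : 0 ≤ S)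
    (hkey : (1 - g ^ 2) * S = δ₁ ^ 2 + δ₂ ^ 2 - 2 * g * δ₁ * δ₂) (hK : 2 ≤ (1 - c) * K ^ 2) : S ≤ (K * d) ^ 2 := by
  have hga : |g| ^ 2 = g ^ 2 := sq_abs g
  have hd0 : 0 ≤ d := (abs_nonneg _).trans hd₁
  have hg0 : 0 ≤ |g| := abs_nonneg g
  have hδ₁' : δ₁ ^ 2 ≤ d ^ 2 := by rw [← sq_abs δ₁]; exact pow_le_pow_left₀ (abs_nonneg _) hd₁ 2
  have hδ₂' : δ₂ ^ 2 ≤ d ^ 2 := by rw [← sq_abs δ₂]; exact pow_le_pow_left₀ (abs_nonneg _) hd₂ 2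
  have hcross : -(2 * g * δ₁ * δ₂) ≤ 2 * |g| * d ^ 2 := by
    have e1 : -(2 * g * δ₁ * δ₂) ≤ |2 * g * δ₁ * δ₂| := neg_le_abs _
    have e2 : |2 * g * δ₁ * δ₂| = 2 * |g| * (|δ₁| * |δ₂|) := by rw [abs_mul, abs_mul, abs_mul, abs_two]; ring
    have e3 : |δ₁| * |δ₂| ≤ d * d := mul_le_mul hd₁ hd₂ (abs_nonneg _) hd0
    nlinarith [abs_nonneg g]
  have hstep : (1 - |g|) * S ≤ 2 * d ^ 2 := by
    have hpos : 0 < 1 + |g| := by linarith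
    have e : (1 + |g|) * ((1 - |g|) * S) = (1 - g ^ 2) * S := by rw [← hga]; ring
    have h' : (1 + |g|) * ((1 - |g|) * S) ≤ (1 + |g|) * (2 * d ^ 2) := by rw [e, hkey]; nlinarith
    exact le_of_mul_le_mul_left h' hpos
  have hcpos : 0 < 1 - c := by linarith
  have h2 : 2 * d ^ 2 ≤ (1 - c) * K ^ 2 * d ^ 2 := mul_le_mul_of_nonneg_right hK (sq_nonneg d)
  have hS : (1 - c) * S ≤ (1 - c) * (K * d) ^ 2 :=
    calc (1 - c) * S ≤ (1 - |g|) * S := mul_le_mul_of_nonneg_right (by linarith) hS0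
      _ ≤ 2 * d ^ 2 := hstep
      _ ≤ (1 - c) * K ^ 2 * d ^ 2 := h2
      _ = (1 - c) * (K * d) ^ 2 := by ring
  exact le_of_mul_le_mul_left hS hcpos

/-- ★ **TWO-PLANE POINT, IN-PLANE FORM.**  Unit normals `n₁`, `n₂` with `|⟪n₁, n₂⟫| ≤ c < 1`, both planes `⟪nᵢ, · − pᵢ⟫ = 0` within `d` of `x`,
constants `K, M ≥ 0` with `(1 − c) K² ≥ 2` and `(1 − c) M² ≥ 1 + c`.  Then a common point `z` of the two planes has `‖z − x‖ ≤ K d` and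
`‖z − pᵢ‖ ≤ ‖x − pᵢ‖ + M d` (`i = 1, 2`).  (Gram system of TREE `…TwoPlane.two_plane_point`, re-derived for the explicit `z = x + α n₁ + β n₂`:
`z − p₁ = lat_{n₁}(x − p₁) + β (n₂ − g n₁)` with `β (1 − g²) = g δ₁ − δ₂`.) [this file · kind: proof] -/
theorem two_plane_inplane {n₁ n₂ x p₁ p₂ : E3} {c d K M : ℝ} (h₁ : ‖n₁‖ = 1) (h₂ : ‖n₂‖ = 1) (hc : |⟪n₁, n₂⟫_ℝ| ≤ c) (hc1 : c < 1)
    (hd₁ : |⟪n₁, x - p₁⟫_ℝ| ≤ d) (hd₂ : |⟪n₂, x - p₂⟫_ℝ| ≤ d) (hK0 : 0 ≤ K) (hK : 2 ≤ (1 - c) * K ^ 2)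
    (hM0 : 0 ≤ M) (hM : 1 + c ≤ (1 - c) * M ^ 2) :
    ∃ z : E3, ⟪n₁, z - p₁⟫_ℝ = 0 ∧ ⟪n₂, z - p₂⟫_ℝ = 0 ∧ ‖z - x‖ ≤ K * d ∧
      ‖z - p₁‖ ≤ ‖x - p₁‖ + M * d ∧ ‖z - p₂‖ ≤ ‖x - p₂‖ + M * d := by
  set g : ℝ := ⟪n₁, n₂⟫_ℝ with hg
  set δ₁ : ℝ := ⟪n₁, x - p₁⟫_ℝ with hδ₁
  set δ₂ : ℝ := ⟪n₂, x - p₂⟫_ℝ with hδ₂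
  have hg1 : |g| < 1 := lt_of_le_of_lt hc hc1
  have hD : 0 < 1 - g ^ 2 := by nlinarith [abs_nonneg g, sq_abs g]
  obtain ⟨hsys₁, hsys₂, hbβ, haα, hkey⟩ := gram_identities g δ₁ δ₂ hD.ne'
  set a : ℝ := (g * δ₂ - δ₁) / (1 - g ^ 2) with ha
  set b : ℝ := (g * δ₁ - δ₂) / (1 - g ^ 2) with hb
  have hn11 : ⟪n₁, n₁⟫_ℝ = 1 := by rw [real_inner_self_eq_norm_sq, h₁]; norm_num
  have hn22 : ⟪n₂, n₂⟫_ℝ = 1 := by rw [real_inner_self_eq_norm_sq, h₂]; norm_num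
  have hn21 : ⟪n₂, n₁⟫_ℝ = g := by rw [hg, real_inner_comm]
  have hd0 : 0 ≤ d := (abs_nonneg _).trans hd₁
  refine ⟨x + a • n₁ + b • n₂, ?_, ?_, ?_, ?_, ?_⟩
  · have hz : x + a • n₁ + b • n₂ - p₁ = (x - p₁) + a • n₁ + b • n₂ := by abel
    rw [hz, inner_add_right, inner_add_right, real_inner_smul_right, real_inner_smul_right, hn11, ← hg, ← hδ₁]
    linear_combination hsys₁
  · have hz : x + a • n₁ + b • n₂ - p₂ = (x - p₂) + a • n₁ + b • n₂ := by abel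
    rw [hz, inner_add_right, inner_add_right, real_inner_smul_right, real_inner_smul_right, hn21, hn22, ← hδ₂]
    linear_combination hsys₂
  · have hz : x + a • n₁ + b • n₂ - x = a • n₁ + b • n₂ := by abel
    have hsq : ‖a • n₁ + b • n₂‖ ^ 2 = a ^ 2 + b ^ 2 + 2 * a * b * g := by
      rw [← real_inner_self_eq_norm_sq]
      simp only [inner_add_left, inner_add_right, real_inner_smul_left, real_inner_smul_right, hn11, hn22, hn21, ← hg]
      ring
    have hS : a ^ 2 + b ^ 2 + 2 * a * b * g ≤ (K * d) ^ 2 :=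
      two_plane_norm_real hc hc1 hd₁ hd₂ (by rw [← hsq]; positivity) hkey hK
    rw [hz]; exact le_of_pow_le_pow_left₀ two_ne_zero (mul_nonneg hK0 hd0) (by rw [hsq]; exact hS)
  · have ha' : a = -δ₁ - b * g := by linarith [hsys₁]
    have hz : x + a • n₁ + b • n₂ - p₁ = ((x - p₁) - δ₁ • n₁) + b • (n₂ - g • n₁) := by
      rw [ha', sub_smul, neg_smul, smul_sub, smul_smul]; abel
    have hB : ‖b • (n₂ - g • n₁)‖ ^ 2 ≤ (M * d) ^ 2 := by
      rw [norm_sq_smul_sub_axis h₁ h₂ hg.symm b]; exact inplane_coeff_bound hc hc1 hd₁ hd₂ hbβ hM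
    have hB' : ‖b • (n₂ - g • n₁)‖ ≤ M * d := le_of_pow_le_pow_left₀ two_ne_zero (mul_nonneg hM0 hd0) hB
    rw [hz]
    exact (norm_add_le _ _).trans (add_le_add (lat_norm_le h₁ (x - p₁)) hB')
  · have hb' : b = -δ₂ - a * g := by linarith [hsys₂]
    have hz : x + a • n₁ + b • n₂ - p₂ = ((x - p₂) - δ₂ • n₂) + a • (n₁ - g • n₂) := by
      rw [hb', sub_smul, neg_smul, smul_sub, smul_smul]; abel
    have hc' : |⟪n₂, n₁⟫_ℝ| ≤ c := by rw [hn21]; exact hc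
    have hA : ‖a • (n₁ - g • n₂)‖ ^ 2 ≤ (M * d) ^ 2 := by
      rw [norm_sq_smul_sub_axis h₂ h₁ hn21 a]; exact inplane_coeff_bound hc hc1 hd₂ hd₁ haα hM
    have hA' : ‖a • (n₁ - g • n₂)‖ ≤ M * d := le_of_pow_le_pow_left₀ two_ne_zero (mul_nonneg hM0 hd0) hA
    rw [hz]
    exact (norm_add_le _ _).trans (add_le_add (lat_norm_le h₂ (x - p₂)) hA')

/-! ## §4 Waypoints on a segment of the local plane -/

/-- ★ **WAYPOINTS.**  `P`, `Z` on the plane with unit normal `n` (`⟪n, Z − P⟫ = 0`), `0 < ν`, `‖lat_n (Z − P)‖ ≤ (957/25) ν`.  Then eight waypoints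
`W 0 = P, W 1, …, W 8` on the segment `[P, Z]` have lateral spacing `≤ (23/5) ν`, zero heights, and leave a last gap `‖lat_n (Z − W 8)‖ ≤ (37/25) ν`
(`W i = P + (i θ) (Z − P)` with `θ = 0` if the gap is already `≤ 1.48 ν`, else `θ = (Λ − 1.48 ν)/(8 Λ)`). [this file · kind: proof] -/
theorem waypoints {n P Z : E3} {ν : ℝ} (hν : 0 < ν) (hPZ : ⟪n, Z - P⟫_ℝ = 0)
    (hΛ : ‖(Z - P) - ⟪n, Z - P⟫_ℝ • n‖ ≤ 957 / 25 * ν) :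
    ∃ W : ℕ → E3, W 0 = P ∧ (∀ i, i < 8 → ‖(W (i + 1) - W i) - ⟪n, W (i + 1) - W i⟫_ℝ • n‖ ≤ 23 / 5 * ν) ∧
      (∀ i, i ≤ 8 → ⟪n, W i - P⟫_ℝ = 0) ∧ ‖(Z - W 8) - ⟪n, Z - W 8⟫_ℝ • n‖ ≤ 37 / 25 * ν ∧
      (∀ i, i ≤ 8 → ∃ θ : ℝ, 0 ≤ θ ∧ θ ≤ 1 ∧ W i = P + θ • (Z - P)) := by
  set Λ : ℝ := ‖(Z - P) - ⟪n, Z - P⟫_ℝ • n‖ with hΛdef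
  obtain ⟨θ, hθ0, hθ8, hsp, hgap⟩ : ∃ θ : ℝ, 0 ≤ θ ∧ 8 * θ ≤ 1 ∧ θ * Λ ≤ 23 / 5 * ν ∧ (1 - 8 * θ) * Λ ≤ 37 / 25 * ν := by
    by_cases hsmall : Λ ≤ 37 / 25 * ν
    · exact ⟨0, le_rfl, by norm_num, by rw [zero_mul]; linarith, by linarith⟩
    · have hΛpos : 0 < Λ := lt_of_lt_of_le (by linarith) (not_le.1 hsmall).le
      have e1 : (Λ - 37 / 25 * ν) / (8 * Λ) * Λ = (Λ - 37 / 25 * ν) / 8 := by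
        rw [div_mul_eq_mul_div, mul_comm (Λ - 37 / 25 * ν) Λ, mul_comm (8 : ℝ) Λ, mul_div_mul_left _ _ hΛpos.ne']
      have e2 : (1 - 8 * ((Λ - 37 / 25 * ν) / (8 * Λ))) * Λ = 37 / 25 * ν := by
        rw [mul_div_assoc', mul_div_mul_left _ _ (by norm_num : (8 : ℝ) ≠ 0), sub_mul, one_mul, div_mul_cancel₀ _ hΛpos.ne']
        ring
      refine ⟨(Λ - 37 / 25 * ν) / (8 * Λ), div_nonneg (by linarith) (by linarith), ?_, ?_, ?_⟩
      · rw [mul_div_assoc', mul_div_mul_left _ _ (by norm_num : (8 : ℝ) ≠ 0), div_le_one hΛpos]; linarith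
      · rw [e1]; linarith
      · rw [e2]
  refine ⟨fun i => P + ((i : ℝ) * θ) • (Z - P), by simp, ?_, ?_, ?_, ?_⟩
  · intro i _
    dsimp only
    have e : (P + (((i + 1 : ℕ) : ℝ) * θ) • (Z - P)) - (P + ((i : ℝ) * θ) • (Z - P)) = θ • (Z - P) := by
      rw [Nat.cast_succ, add_mul, one_mul, add_smul]; abel
    rw [e, lat_smul, norm_smul, Real.norm_of_nonneg hθ0]; exact hsp
  · intro i _
    dsimp only
    have e : P + ((i : ℝ) * θ) • (Z - P) - P = ((i : ℝ) * θ) • (Z - P) := by abel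
    rw [e, real_inner_smul_right, hPZ, mul_zero]
  · show ‖(Z - (P + (((8 : ℕ) : ℝ) * θ) • (Z - P))) - ⟪n, Z - (P + (((8 : ℕ) : ℝ) * θ) • (Z - P))⟫_ℝ • n‖ ≤ 37 / 25 * ν
    have e : Z - (P + (((8 : ℕ) : ℝ) * θ) • (Z - P)) = (1 - 8 * θ) • (Z - P) := by
      rw [sub_smul, one_smul]; push_cast; abel
    have h18 : 0 ≤ 1 - 8 * θ := by linarith
    rw [e, lat_smul, norm_smul, Real.norm_of_nonneg h18]; exact hgap
  · intro i hi
    have hi' : (i : ℝ) ≤ 8 := by exact_mod_cast hi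
    exact ⟨(i : ℝ) * θ, mul_nonneg (Nat.cast_nonneg i) hθ0, by nlinarith [hi', hθ0, hθ8], rfl⟩

section Atlas
/-! ONE chart datum on the ball `B(y j, ρ₁ ν_j)` (verbatim §2 of part 22A). -/
variable {y : Fin N → E3} (hy : Function.Injective y) {j : Fin N} {ρ₁ : ℝ}
  {Ac : Fin N → (E3 →ₗ[ℝ] E3)} {Qc : Fin N → (E3 →ₗᵢ[ℝ] E3)} {Pc : Fin N → Finset E3} {fc : Fin N → E3 → E3}
  (hP : ∀ i, dist (y i) (y j) ≤ ρ₁ * nearestDist y j → Pc i = fccTwoShellPattern ∨ Pc i = hcpTwoShellPattern)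
  (hA : ∀ i, dist (y i) (y j) ≤ ρ₁ * nearestDist y j → ∀ v ∈ Pc i, ‖Ac i v - Qc i v‖ ≤ 1 / 1000)
  (hf : ∀ i, dist (y i) (y j) ≤ ρ₁ * nearestDist y j → ∀ v ∈ Pc i,
    fc i v ∈ Set.range y ∧ dist (fc i v) (y i + nearestDist y i • Ac i v) ≤ 1 / 10 ^ 4 * nearestDist y i)
  (hinj : ∀ i, dist (y i) (y j) ≤ ρ₁ * nearestDist y j → Set.InjOn (fc i) ↑(Pc i))
  (hex : ∀ i, dist (y i) (y j) ≤ ρ₁ * nearestDist y j → ∀ k : Fin N, k ≠ i →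
    dist (y k) (y i) ≤ (3 / 2 + 1 / 450) * nearestDist y i → ∃ v ∈ Pc i, fc i v = y k)

include hy hP hA hf hinj hex

/-! ## §5 The net pursuit -/

/-- ★ **NET HOPS.**  An h-site `a₀` of the ball, `n` the unit axis of its chart, targets `V 0, …, V 3` with `‖lat_n (V 0 − y a₀)‖ ≤ 2.12 ν_0`,
`‖lat_n (V (s+1) − V s)‖ ≤ 1.48 ν_0`, heights `≤ η ν_0`, `2.12² + (η + 0.61)² ≤ E²` and the REGION inequality `dist (V s) (y j) + (E + 1.03) ν_0 ≤
ρ₁ ν_j`.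
Then for every `q ≤ 3` an h-chain `c 0 = a₀, …, c L` (`L ≤ 3 (q + 1)`) of sites of the ball, h-sites, basal steps, ends at lateral distance
`≤ (16/25) ν_0` from `V q` (ONE chain, `q + 1` hops of mode `(3, 2.12)` of part 22A; `1.48 + 0.64 = 2.12`). [this file · kind: proof] -/
theorem net_hops {a₀ : Fin N} (hball₀ : dist (y a₀) (y j) ≤ ρ₁ * nearestDist y j) (hP₀ : Pc a₀ = hcpTwoShellPattern)
    {n : E3} (hn : n = (‖Ac a₀ ((Real.sqrt 18)⁻¹ • intVec ![4, 4, 4])‖⁻¹ • Ac a₀ ((Real.sqrt 18)⁻¹ • intVec ![4, 4, 4]) : E3))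
    (V : ℕ → E3) {η E : ℝ} (hV0 : ‖(V 0 - y a₀) - ⟪n, V 0 - y a₀⟫_ℝ • n‖ ≤ 53 / 25 * nearestDist y a₀)
    (hVsp : ∀ s, s < 3 → ‖(V (s + 1) - V s) - ⟪n, V (s + 1) - V s⟫_ℝ • n‖ ≤ 37 / 25 * nearestDist y a₀)
    (hVη : ∀ s, s ≤ 3 → |⟪n, V s - y a₀⟫_ℝ| ≤ η * nearestDist y a₀) (hE0 : 0 ≤ E)
    (hE : (53 / 25 : ℝ) ^ 2 + (η + 61 / 100) ^ 2 ≤ E ^ 2)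
    (hVreg : ∀ s, s ≤ 3 → dist (V s) (y j) + (E + 103 / 100) * nearestDist y a₀ ≤ ρ₁ * nearestDist y j) :
    ∀ q, q ≤ 3 → ∃ (c : ℕ → Fin N) (w : ℕ → E3) (L : ℕ), L ≤ 3 * (q + 1) ∧ c 0 = a₀ ∧
      (∀ t, t ≤ L → dist (y (c t)) (y j) ≤ ρ₁ * nearestDist y j ∧ Pc (c t) = hcpTwoShellPattern) ∧
      (∀ t, t < L → w t ∈ hcpTwoShellPattern ∧ w t 0 + w t 1 + w t 2 = 0 ∧ fc (c t) (w t) = y (c (t + 1))) ∧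
      ‖(V q - y (c L)) - ⟪n, V q - y (c L)⟫_ℝ • n‖ ≤ 16 / 25 * nearestDist y a₀ := by
  intro q
  induction q with
  | zero =>
    intro _
    have hpre : ∀ t, t ≤ 0 → dist (y ((fun _ : ℕ => a₀) t)) (y j) ≤ ρ₁ * nearestDist y j ∧ Pc ((fun _ : ℕ => a₀) t) = hcpTwoShellPattern :=
      fun t _ => ⟨hball₀, hP₀⟩
    have hstep : ∀ t, t < 0 → (fun _ : ℕ => (0 : E3)) t ∈ hcpTwoShellPattern ∧
        (fun _ : ℕ => (0 : E3)) t 0 + (fun _ : ℕ => (0 : E3)) t 1 + (fun _ : ℕ => (0 : E3)) t 2 = 0 ∧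
        fc ((fun _ : ℕ => a₀) t) ((fun _ : ℕ => (0 : E3)) t) = y ((fun _ : ℕ => a₀) (t + 1)) :=
      fun t ht => absurd ht (Nat.not_lt_zero _)
    obtain ⟨c', w', s, hs, hc'le, -, hpre', hstep', hlat'⟩ :=
      sheet_hop hy hP hA hf hinj hex (k := 3) (τ := 53 / 25) (Or.inr (Or.inr ⟨rfl, rfl⟩)) (by omega) hpre hstep hn (V 0)
        (hVη 0 (Nat.zero_le _)) hE0 hE (hVreg 0 (Nat.zero_le _)) hV0
    exact ⟨c', w', 0 + s, by omega, hc'le 0 le_rfl, hpre', hstep', hlat'⟩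
  | succ q ih =>
    intro hq
    obtain ⟨c, w, L, hL, hc0, hpre, hstep, hlat⟩ := ih (by omega)
    have hn' : n = (‖Ac (c 0) ((Real.sqrt 18)⁻¹ • intVec ![4, 4, 4])‖⁻¹ • Ac (c 0) ((Real.sqrt 18)⁻¹ • intVec ![4, 4, 4]) : E3) := by
      rw [hc0]; exact hn
    have hη' : |⟪n, V (q + 1) - y (c 0)⟫_ℝ| ≤ η * nearestDist y (c 0) := by rw [hc0]; exact hVη (q + 1) hq
    have hreg' : dist (V (q + 1)) (y j) + (E + 103 / 100) * nearestDist y (c 0) ≤ ρ₁ * nearestDist y j := by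
      rw [hc0]; exact hVreg (q + 1) hq
    have hR0 : ‖(V (q + 1) - y (c L)) - ⟪n, V (q + 1) - y (c L)⟫_ℝ • n‖ ≤ 53 / 25 * nearestDist y (c 0) := by
      have e : V (q + 1) - y (c L) = (V (q + 1) - V q) + (V q - y (c L)) := by abel
      rw [e, hc0]
      exact (lat_add_le n _ _).trans (by linarith [hVsp q (by omega), hlat])
    obtain ⟨c', w', s, hs, hc'le, -, hpre', hstep', hlat'⟩ :=
      sheet_hop hy hP hA hf hinj hex (k := 3) (τ := 53 / 25) (Or.inr (Or.inr ⟨rfl, rfl⟩)) (by omega) hpre hstep hn' (V (q + 1))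
        hη' hE0 hE hreg' hR0
    refine ⟨c', w', L + s, by omega, by rw [hc'le 0 (Nat.zero_le _), hc0], hpre', hstep', ?_⟩
    rw [hc0] at hlat'
    exact hlat'

/-- ★★ **NET SITE.**  Under the hypotheses of `net_hops`: for every `q ≤ 3` there is a site `a` of the ball, an h-site, with `0 < ν_a`, flat to
`ν_a / 10` over the plane `(y a₀, n)`, laterally within `(3/4) ν_a` of `V q`, whose chart unit axis is within `1/250` of `±n`
(the stopping site of `net_hops`; `chain_guard` at `t ≤ 12`: height `0.0487 ν_0`, window `±0.0062 ν_0`, axis `0.00312`). [this file · kind: proof] -/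
theorem net_site {a₀ : Fin N} (hball₀ : dist (y a₀) (y j) ≤ ρ₁ * nearestDist y j) (hP₀ : Pc a₀ = hcpTwoShellPattern)
    {n : E3} (hn : n = (‖Ac a₀ ((Real.sqrt 18)⁻¹ • intVec ![4, 4, 4])‖⁻¹ • Ac a₀ ((Real.sqrt 18)⁻¹ • intVec ![4, 4, 4]) : E3))
    (V : ℕ → E3) {η E : ℝ} (hV0 : ‖(V 0 - y a₀) - ⟪n, V 0 - y a₀⟫_ℝ • n‖ ≤ 53 / 25 * nearestDist y a₀)
    (hVsp : ∀ s, s < 3 → ‖(V (s + 1) - V s) - ⟪n, V (s + 1) - V s⟫_ℝ • n‖ ≤ 37 / 25 * nearestDist y a₀)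
    (hVη : ∀ s, s ≤ 3 → |⟪n, V s - y a₀⟫_ℝ| ≤ η * nearestDist y a₀) (hE0 : 0 ≤ E)
    (hE : (53 / 25 : ℝ) ^ 2 + (η + 61 / 100) ^ 2 ≤ E ^ 2)
    (hVreg : ∀ s, s ≤ 3 → dist (V s) (y j) + (E + 103 / 100) * nearestDist y a₀ ≤ ρ₁ * nearestDist y j) :
    ∀ q, q ≤ 3 → ∃ a : Fin N, dist (y a) (y j) ≤ ρ₁ * nearestDist y j ∧ Pc a = hcpTwoShellPattern ∧ 0 < nearestDist y a ∧
      |⟪n, y a - y a₀⟫_ℝ| ≤ 1 / 10 * nearestDist y a ∧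
      ‖(V q - y a) - ⟪n, V q - y a⟫_ℝ • n‖ ≤ 3 / 4 * nearestDist y a ∧
      ∃ σ : ℝ, (σ = 1 ∨ σ = -1) ∧
        ‖(‖Ac a ((Real.sqrt 18)⁻¹ • intVec ![4, 4, 4])‖⁻¹ • Ac a ((Real.sqrt 18)⁻¹ • intVec ![4, 4, 4]) : E3) - σ • n‖ ≤ 1 / 250 := by
  intro q hq
  obtain ⟨c, w, L, hL, hc0, hpre, hstep, hlat⟩ := net_hops hy hP hA hf hinj hex hball₀ hP₀ hn V hV0 hVsp hVη hE0 hE hVreg q hq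
  have hn' : n = (‖Ac (c 0) ((Real.sqrt 18)⁻¹ • intVec ![4, 4, 4])‖⁻¹ • Ac (c 0) ((Real.sqrt 18)⁻¹ • intVec ![4, 4, 4]) : E3) := by
    rw [hc0]; exact hn
  obtain ⟨⟨σ, hσ, hax⟩, hwin, hht⟩ := chain_guard hy hA hf hinj hex (t := L) (by omega) hpre hstep hn'
  obtain ⟨-, hf0, hinj0, -⟩ := site_charts hA hf hinj hex hball₀ hP₀
  have hν₀ : 0 < nearestDist y a₀ := nearestDist_pos_of_frame hy (Or.inr rfl) (fun v hv => (hf0 v hv).1) hinj0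
  rw [hc0] at hwin hht
  have hL' : (L : ℝ) ≤ 12 := by exact_mod_cast (show L ≤ 12 by omega)
  have hL0 : (0 : ℝ) ≤ L := Nat.cast_nonneg L
  have hlo := (abs_le.1 hwin).1
  have hw : (26 / 10000 + 3 / 10000 * (L : ℝ)) * nearestDist y a₀ ≤ 62 / 10000 * nearestDist y a₀ :=
    mul_le_mul_of_nonneg_right (by linarith) hν₀.le
  have hh : (13 / 100000 * (L : ℝ) ^ 2 + 25 / 10000 * L) * nearestDist y a₀ ≤ 4872 / 100000 * nearestDist y a₀ :=
    mul_le_mul_of_nonneg_right (by nlinarith) hν₀.le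
  refine ⟨c L, (hpre L le_rfl).1, (hpre L le_rfl).2, by linarith, ?_, ?_, σ, hσ, hax.trans (by linarith)⟩
  · exact hht.trans (by linarith)
  · exact hlat.trans (by linarith)

end Atlas
end Summit.AtomisticToContinuum.Crystallization.Theorems.OverbindingBudgetAffineRunCutSheetNets
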